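import Literature.NumberTheory.Sieve.LevelOfDistribution
import Mathlib.Analysis.SpecialFunctions.Pow.Asymptotics
import Mathlib.Analysis.Complex.ExponentialBounds

/-!
# `ElliottHalberstam` (stmt-Parity-14092): the restriction to coprime classes is load-bearing

Negative lemma for the crux `Literature.NumberTheory.Sieve.LevelOfDistribution.ElliottHalberstam` (the
Elliott–Halberstam conjecture, by name; cdisprove work file `Cruxes/ElliottHalberstam/Disproof.lean` §6):
replacing, in `primeAPError`, the sup over units `a : (ZMod q)ˣ` by a sup over ALL classes `a : ZMod q`
(`primeAPErrorAll`, `PrimesHaveLevelAllResidues`, `ElliottHalberstamWithoutCoprime`) makes the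
Bombieri–Vinogradov shape false for every `θ > 0`: the single modulus `q = 2`, class `0`, height `y = x`
has error `≥ x/φ(2) − ψ(x;2,0) ≥ x − (x+1) log 2` (`primesHaveLevelAllResidues_false`,
`elliottHalberstam_false_without_coprime`). The tree's `primeAPError` ranges over `(ZMod q)ˣ`, as it must.
[folklore]
-/

namespace Summit.Parity.GeneralizedHardyLittlewood.Theorems.ElliottHalberstam.Negative

open Filter Asymptotics Finset Real
open Literature.NumberTheory.Sieve Literature.NumberTheory.Sieve.LevelOfDistribution

/-! ## §6 Load-bearing coprimality `(a, q) = 1` -/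

/-- `E*` with the sup over ALL residue classes `a : ZMod q` (coprimality dropped). -/
noncomputable def primeAPErrorAll (x : ℝ) (q : ℕ) : ℝ :=
  ⨆ y : Set.Icc (1 : ℝ) x, ⨆ a : ZMod q, |chebyshevPsiMod q a y - (y : ℝ) / Nat.totient q|

/-- The Bombieri–Vinogradov shape at level `x^{θ−ε}` with coprimality dropped. -/
def PrimesHaveLevelAllResidues (θ : ℝ) : Prop :=
  ∀ A : ℝ, 0 < A → ∀ ε : ℝ, 0 < ε →
    (fun x : ℝ => ∑ q ∈ Icc 1 ⌊x ^ (θ - ε)⌋₊, primeAPErrorAll x q) =O[atTop]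
      fun x : ℝ => x / Real.log x ^ A

/-- The crux with coprimality dropped. -/
def ElliottHalberstamWithoutCoprime : Prop :=
  ∀ θ : ℝ, θ < 1 → PrimesHaveLevelAllResidues θ

/-- The all-residue inner range is bounded (same bound `ψ(x) + x` as the tree's
`bddAbove_range_primeAPError`). -/
theorem bddAbove_range_primeAPErrorAll (x : ℝ) (q : ℕ) [NeZero q] :
    BddAbove (Set.range fun y : Set.Icc (1 : ℝ) x ↦
      ⨆ a : ZMod q, |chebyshevPsiMod q a y - (y : ℝ) / Nat.totient q|) := by
  refine ⟨(∑ n ∈ range (⌊x⌋₊ + 1), ArithmeticFunction.vonMangoldt n) + x, ?_⟩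
  rintro _ ⟨y, rfl⟩
  have hy1 : (1 : ℝ) ≤ y := y.2.1
  have hyx : (y : ℝ) ≤ x := y.2.2
  have hS : 0 ≤ ∑ n ∈ range (⌊x⌋₊ + 1), ArithmeticFunction.vonMangoldt n :=
    Finset.sum_nonneg fun _ _ => ArithmeticFunction.vonMangoldt_nonneg
  have hφ : (1 : ℝ) ≤ (Nat.totient q : ℝ) := by
    exact_mod_cast Nat.totient_pos.mpr (Nat.pos_of_ne_zero (NeZero.ne q))
  refine ciSup_le fun a => abs_le.mpr ⟨?_, ?_⟩
  · have h1 : 0 ≤ chebyshevPsiMod q a y :=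
      Finset.sum_nonneg fun n _ => ArithmeticFunction.vonMangoldt.residueClass_nonneg a n
    have h2 : (y : ℝ) / Nat.totient q ≤ x := (div_le_self (by linarith) hφ).trans hyx
    linarith
  · have h1 : chebyshevPsiMod q a y ≤ ∑ n ∈ range (⌊x⌋₊ + 1), ArithmeticFunction.vonMangoldt n :=
      (Finset.sum_le_sum fun n _ => ArithmeticFunction.vonMangoldt.residueClass_le a n).trans
        (Finset.sum_le_sum_of_subset_of_nonneg
          (Finset.range_mono (Nat.succ_le_succ (Nat.floor_le_floor hyx)))
          fun _ _ _ => ArithmeticFunction.vonMangoldt_nonneg)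
    have h2 : 0 ≤ (y : ℝ) / Nat.totient q := div_nonneg (by linarith) (Nat.cast_nonneg _)
    linarith

/-- Each individual all-residue error is at most `primeAPErrorAll x q`. -/
theorem abs_sub_le_primeAPErrorAll {x y : ℝ} {q : ℕ} [NeZero q] (hy1 : 1 ≤ y) (hyx : y ≤ x)
    (a : ZMod q) :
    |chebyshevPsiMod q a y - y / Nat.totient q| ≤ primeAPErrorAll x q := by
  unfold primeAPErrorAll
  refine le_trans ?_ (le_ciSup (bddAbove_range_primeAPErrorAll x q) ⟨y, hy1, hyx⟩)
  exact le_ciSup (f := fun a : ZMod q => |chebyshevPsiMod q a y - y / Nat.totient q|)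
    (Set.finite_range _).bddAbove a

/-- On the even numbers `Λ` is at most `log 2` (an even prime power is a power of `2`). -/
theorem residueClass_zero_two_le (n : ℕ) :
    ArithmeticFunction.vonMangoldt.residueClass (0 : ZMod 2) n ≤ Real.log 2 := by
  have hlog2 : 0 ≤ Real.log 2 := Real.log_nonneg (by norm_num)
  simp only [ArithmeticFunction.vonMangoldt.residueClass, Set.indicator_apply, Set.mem_setOf_eq]
  split_ifs with h
  · by_cases hΛ : ArithmeticFunction.vonMangoldt n = 0
    · rw [hΛ]; exact hlog2
    · obtain ⟨p, k, hp, hk, rfl⟩ :=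
        (isPrimePow_nat_iff _).mp (ArithmeticFunction.vonMangoldt_ne_zero_iff.mp hΛ)
      have h2 : 2 ∣ p ^ k := (ZMod.natCast_eq_zero_iff _ _).mp h
      have hp2 : p = 2 :=
        ((Nat.prime_dvd_prime_iff_eq Nat.prime_two hp).mp (Nat.prime_two.dvd_of_dvd_pow h2)).symm
      subst hp2
      rw [ArithmeticFunction.vonMangoldt_apply_pow hk.ne',
        ArithmeticFunction.vonMangoldt_apply_prime Nat.prime_two]
      push_cast
      exact le_rfl
  · exact hlog2

/-- `ψ(y; 2, 0) ≤ (⌊y⌋ + 1) log 2`. -/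
theorem chebyshevPsiMod_two_zero_le (y : ℝ) :
    chebyshevPsiMod 2 0 y ≤ ((⌊y⌋₊ : ℝ) + 1) * Real.log 2 := by
  unfold chebyshevPsiMod
  calc ∑ n ∈ range (⌊y⌋₊ + 1), ArithmeticFunction.vonMangoldt.residueClass (0 : ZMod 2) n
      ≤ #(range (⌊y⌋₊ + 1)) • Real.log 2 :=
        Finset.sum_le_card_nsmul _ _ _ fun n _ => residueClass_zero_two_le n
    _ = ((⌊y⌋₊ : ℝ) + 1) * Real.log 2 := by
        rw [Finset.card_range, nsmul_eq_mul]; push_cast; ring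

/-- **Coprimality is load-bearing**: with the sup over ALL classes, the shape is false for every
`θ > 0` — the single modulus `q = 2`, class `0`, height `y = x` has error
`≥ x/φ(2) − ψ(x;2,0) ≥ x − (x+1) log 2 ≥ x/4`, not `O(x/log x)`. (The tree's `primeAPError` ranges
over `(ZMod q)ˣ`, as it must.) -/
theorem primesHaveLevelAllResidues_false {θ : ℝ} (hθ : 0 < θ) : ¬ PrimesHaveLevelAllResidues θ := by
  intro h
  obtain ⟨C, hC, hCb⟩ := (h 1 one_pos (θ / 2) (by linarith)).exists_pos
  have hev := hCb.bound
  have e : θ - θ / 2 = θ / 2 := by ring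
  rw [e] at hev
  have h2 : ∀ᶠ x : ℝ in atTop, 2 ≤ x ^ (θ / 2) :=
    (tendsto_rpow_atTop (by linarith : 0 < θ / 2)).eventually_ge_atTop 2
  have hlog : ∀ᶠ x : ℝ in atTop, 20 * C + 20 ≤ Real.log x :=
    Real.tendsto_log_atTop.eventually_ge_atTop _
  obtain ⟨x, hxb, hx2, hxlog, hx10⟩ :=
    (hev.and (h2.and (hlog.and (eventually_ge_atTop (10 : ℝ))))).exists
  have hx0 : 0 < x := by linarith
  have hlogpos : 0 < Real.log x := by linarith
  have hq : 2 ∈ Icc 1 ⌊x ^ (θ / 2)⌋₊ := by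
    rw [Finset.mem_Icc]; exact ⟨by norm_num, Nat.le_floor (by exact_mod_cast hx2)⟩
  have hS0 : ∀ q ∈ Icc 1 ⌊x ^ (θ / 2)⌋₊, 0 ≤ primeAPErrorAll x q := fun q _ =>
    Real.iSup_nonneg fun _ => Real.iSup_nonneg fun _ => abs_nonneg _
  have hterm : primeAPErrorAll x 2 ≤ ∑ q ∈ Icc 1 ⌊x ^ (θ / 2)⌋₊, primeAPErrorAll x q :=
    Finset.single_le_sum hS0 hq
  have hU : ∑ q ∈ Icc 1 ⌊x ^ (θ / 2)⌋₊, primeAPErrorAll x q ≤ C * (x / Real.log x) := by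
    have := hxb
    rw [Real.rpow_one, Real.norm_eq_abs, Real.norm_eq_abs, abs_of_nonneg (Finset.sum_nonneg hS0),
      abs_of_nonneg (div_nonneg hx0.le hlogpos.le)] at this
    exact this
  -- lower bound at q = 2, a = 0, y = x
  have hlow : x - (x + 1) * Real.log 2 ≤ primeAPErrorAll x 2 := by
    have key := abs_sub_le_primeAPErrorAll (q := 2) (x := x) (by linarith : (1 : ℝ) ≤ x) le_rfl 0
    have hφ2 : (Nat.totient 2 : ℝ) = 1 := by rw [Nat.totient_two]; push_cast; rfl
    have hψ := chebyshevPsiMod_two_zero_le x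
    have hfl : (⌊x⌋₊ : ℝ) ≤ x := Nat.floor_le hx0.le
    have hlog2 : 0 < Real.log 2 := Real.log_pos (by norm_num)
    rw [hφ2, div_one] at key
    have habs : x - chebyshevPsiMod 2 0 x ≤ |chebyshevPsiMod 2 0 x - x| := by
      rw [abs_sub_comm]; exact le_abs_self _
    have hmono : ((⌊x⌋₊ : ℝ) + 1) * Real.log 2 ≤ (x + 1) * Real.log 2 :=
      mul_le_mul_of_nonneg_right (by linarith) hlog2.le
    linarith
  have hCx : C * (x / Real.log x) ≤ x / 20 := by
    rw [mul_div_assoc', div_le_div_iff₀ hlogpos (by norm_num : (0 : ℝ) < 20)]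
    nlinarith
  have hl2 : (x + 1) * Real.log 2 < (x + 1) * 0.6931471808 :=
    mul_lt_mul_of_pos_left Real.log_two_lt_d9 (by linarith)
  linarith

/-- Any proof of the crux must use the restriction to coprime classes. -/
theorem elliottHalberstam_false_without_coprime : ¬ ElliottHalberstamWithoutCoprime := fun h =>
  primesHaveLevelAllResidues_false one_half_pos (h (1 / 2) (by norm_num))

end Summit.Parity.GeneralizedHardyLittlewood.Theorems.ElliottHalberstam.Negative
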